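import Summits.QuantumFields.BalabanUV.T4Continuum.Support.RegionGaugeOrbit
import Literature.MathematicalPhysics.QuantumFieldTheory.Balaban1983to89.B5Hk160Torus

/-!
# `BalabanUV.T4Continuum.Support.RegionGaugeCheckerboardField` — NE2 (node U1a) formalisation swarm, sub-row `T4-U1a.S-NE2-D1-DIRICHLET°`
# (vector layer, W1), FINDING F-ne2leaf09g9-1: THE CHECKERBOARD TEST FIELD — on the complement `S✗` of a DIAGONAL PAIR of blocks `w`,
# `w′ = w + e + e_ν`, the star-bond field `A = ∂1_{w′}` is CURL-FREE, has mass term `n^d·nsq (avgR A) ≤ 2d·n^d`, and its distance to the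
# Dirichlet gauge orbit is the lattice capacity between `w` and `w′` (file 2 bounds it below by `n^d·H_n/3`)
# (unit b2b-balaban-t4-ne2-formalise-leaf-09, gen 9, v1)

HONEST FRAMING (T4-DAG p. 1).  [folklore] `U = 1`, model level, ONE region family (the complement of two diagonally adjacent unit blocks in a
torus with `2 ≤ M e`, `2 ≤ M ν`), one scale, star bonds; a TEST FIELD and its bookkeeping towards a located NO-GO for the displayed W1 binder
with ONE level-uniform constant on GENERAL block unions (file 2 `RegionGaugeCheckerboardNoGo`); it says nothing about boxes, `e`-thin sets,
`S = ⊤`, or [B9]'s regions with their collars; nothing printed is a hypothesis; NE2 (U1a) NOT proved; spine PROVED 0/9 unchanged; NOT [B9]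
(3.23)–(3.27) as printed; NOT infinite volume, NOT the mass gap, NOT Clay.  HONEST DEPENDENCY (verbatim): «continuum YM on T⁴ ⇐ BetaPertH ∧
nine spine estimates (0/9 proved); BetaPertH ⇐ (D1) ∧ (D4) ∧ CAP+tail; G-an2-4 gates asym, D1 and NE2/3/4.»

WHAT THIS FILE PROVES (0 sorry):
 * §1 the region `checker w e ν := {y : y ≠ w ∧ y ≠ w + e + e_ν}`, the block indicator `blockInd w′` on the fine torus, and the geometry of the
   diagonal pair: `w ≠ w′`, and NO fine bond joins `w` to `w′` (`not_adjacent`) when `2 ≤ M e`, `2 ≤ M ν`, `e ≠ ν`.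
 * §2 the test field **`testField`** `= ∂(blockInd w′)` read on the star bonds; **`ext_testField`**: its zero-extension IS `∂(blockInd w′)` on the
   whole torus (the gradient of the indicator vanishes on every non-star bond); hence **`curlR_testField : curlR … *ᵥ testField = 0`**.
 * §3 the mass term: `avgR testField = ∂₁ 1_{w′}` («Q∂ = ∂₁Q′» `B5Hk160Torus.QvOp_GradOp_mulVec` + `Q′` of a block-constant function), and **`mass_testField_le`**:
   `n^d·nsq (avgR testField) ≤ 2d·n^d`.
 * §4 the Dirichlet data of the orbit: for every Dirichlet `μ` on `Ω`, `testField − ∂_Ω μ = ∂(blockInd w′ − ext μ)` on the star bonds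
   (`sub_gradR_eq`), with `blockInd w′ − ext μ = 0` on the sites of `w` and `= 1` on the sites of `w′` (`phi_on_w`, `phi_on_w'`).

ABSOLUTE RULE (cell, verbatim): «No internally-minted statement may enter as a cited fact. Every hypothesis is either kernel-proved in
this package or a verbatim quotation of a PUBLISHED theorem with page reference. The manuscript(s) under audit are NOT citable for
their own disputed steps — they are the thing under adjudication; programme-internal (2001/route/tribunal) claims are never citable.»
[folklore] throughout; data defs `checker`, `blockInd`, `testField`; no `def … : Prop`.  NOT CLAIMED: the no-go itself (file 2); NE2; NE3.
-/

noncomputable section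

open scoped BigOperators ComplexConjugate Matrix
open Finset

namespace Summit.QuantumFields.BalabanUV.T4Continuum.RegionGaugeCheckerboardField

open Literature.MathematicalPhysics.QuantumFieldTheory.Balaban1983to89.B5Prop11Plancherel (Tor fine unitVec)
open Literature.MathematicalPhysics.QuantumFieldTheory.Balaban1983to89.B5Prop11Lower (nsq nsq_nonneg)
open Literature.MathematicalPhysics.QuantumFieldTheory.Balaban1983to89.B5Action121 (GradOp GradOp_mulVec sdiff_mulVec CurlOp)
open Literature.MathematicalPhysics.QuantumFieldTheory.Balaban1983to89.B5Block118 (bpt QsOp QvOp)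
open Literature.MathematicalPhysics.QuantumFieldTheory.Balaban1983to89.B5Blocks16 (blockOf blockOf_bpt QsOp_blockConst)
open Literature.MathematicalPhysics.QuantumFieldTheory.Balaban1983to89.B5Hk160Torus (QvOp_GradOp_mulVec)
open Summit.QuantumFields.BalabanUV.T4Continuum
open Summit.QuantumFields.BalabanUV.T4Continuum.SubtypeCompression (ext ext_apply_of ext_apply_of_not nsq_ext)
open Summit.QuantumFields.BalabanUV.T4Continuum.RegionGaugeFixedVector (starReg curlR gradR avgR CurlOp_mulVec_GradOp QvOp_mul_GradOp_apply)
open Summit.QuantumFields.BalabanUV.T4Continuum.RegionGaugeFixedVectorFlat (submatrix_mulVec_eq avgR_mulVec blockOf_add_unitVec)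
open Summit.QuantumFields.BalabanUV.Beta.GAN24.DirichletBoxCompression (toBlock_mulVec')
open Summit.QuantumFields.BalabanUV.Beta.GAN24.DirichletBoxTrace (blockReg)

variable {d : ℕ} (n : ℕ) [NeZero n] (M : Fin d → ℕ) [hM : ∀ μ, NeZero (M μ)] (w : Tor M) (e ν : Fin d)

/-! ## §1 The diagonal pair and its complement -/

/-- the second block of the diagonal pair: `w′ = w + e + e_ν`. [folklore] -/
def wp : Tor M := w + unitVec M e + unitVec M ν

/-- **THE CHECKERBOARD REGION**: every unit block except the diagonal pair `w`, `w′`. [folklore] -/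
def checker : Tor M → Prop := fun y => y ≠ w ∧ y ≠ wp M w e ν

/-- decidability. [folklore] -/
instance decChecker : DecidablePred (checker M w e ν) := fun y => inferInstanceAs (Decidable (y ≠ w ∧ y ≠ wp M w e ν))

/-- the BLOCK INDICATOR of `w′` on the fine torus. [folklore] -/
def blockInd : Tor (fine n M) → ℂ := fun x => if blockOf n M x = wp M w e ν then 1 else 0

variable {M w e ν}

omit [NeZero n] hM in
/-- on a torus direction with `2 ≤ M e`: `(e_e)_e = 1 ≠ 0`. [folklore] -/
theorem one_ne_zero_of_two_le (hMe : 2 ≤ M e) : (1 : ZMod (M e)) ≠ 0 := by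
  haveI : Fact (1 < M e) := ⟨hMe⟩
  exact one_ne_zero

omit [NeZero n] hM in
/-- `w ≠ w′` (compare the `e`-coordinates: `(w′)_e = w_e + 1`). [folklore] -/
theorem w_ne_wp (hMe : 2 ≤ M e) (hne : e ≠ ν) : w ≠ wp M w e ν := by
  intro h
  have h1 := congrFun h e
  simp only [wp, Pi.add_apply, unitVec, Pi.single_eq_same, Pi.single_eq_of_ne hne] at h1
  exact one_ne_zero_of_two_le hMe (by simpa using h1.symm)

omit [NeZero n] hM in
/-- no unit step leads from `w` to `w′`: `w + e_μ ≠ w′` for every `μ` (`2 ≤ M e`, `2 ≤ M ν`, `e ≠ ν`). [folklore] -/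
theorem w_add_ne_wp (hMe : 2 ≤ M e) (hMν : 2 ≤ M ν) (hne : e ≠ ν) (μ : Fin d) : w + unitVec M μ ≠ wp M w e ν := by
  intro h
  have hE := congrFun h e
  have hN := congrFun h ν
  simp only [wp, Pi.add_apply, unitVec, Pi.single_eq_same, Pi.single_eq_of_ne hne, Pi.single_eq_of_ne hne.symm, add_zero] at hE hN
  by_cases hμe : μ = e
  · subst hμe
    rw [Pi.single_eq_of_ne hne.symm] at hN
    exact one_ne_zero_of_two_le hMν (by simpa using hN.symm)
  · rw [Pi.single_eq_of_ne (Ne.symm hμe)] at hE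
    exact one_ne_zero_of_two_le hMe (by simpa using hE.symm)

omit [NeZero n] hM in
/-- and none from `w′` to `w`: `w′ + e_μ ≠ w`. [folklore] -/
theorem wp_add_ne_w (hMe : 2 ≤ M e) (hMν : 2 ≤ M ν) (hne : e ≠ ν) (μ : Fin d) : wp M w e ν + unitVec M μ ≠ w := by
  intro h
  have hE := congrFun h e
  have hN := congrFun h ν
  simp only [wp, Pi.add_apply, unitVec, Pi.single_eq_same, Pi.single_eq_of_ne hne, Pi.single_eq_of_ne hne.symm, add_zero] at hE hN
  haveI : Fact (1 < M e) := ⟨hMe⟩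
  haveI : Fact (1 < M ν) := ⟨hMν⟩
  by_cases hμe : μ = e
  · subst hμe
    rw [Pi.single_eq_of_ne hne.symm, add_zero] at hN
    -- `w_ν + 1 = w_ν`
    exact one_ne_zero ((add_eq_left).mp hN)
  · rw [Pi.single_eq_of_ne (Ne.symm hμe), add_zero] at hE
    exact one_ne_zero ((add_eq_left).mp hE)

/-- the indicator is `1` on the sites of `w′` … [folklore] -/
theorem blockInd_of_wp {x : Tor (fine n M)} (hx : blockOf n M x = wp M w e ν) : blockInd n M w e ν x = 1 := if_pos hx

/-- … and `0` off them. [folklore] -/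
theorem blockInd_of_ne {x : Tor (fine n M)} (hx : blockOf n M x ≠ wp M w e ν) : blockInd n M w e ν x = 0 := if_neg hx

/-- a site outside `Ω = blockReg (checker)` lies in `w` or in `w′`. [folklore] -/
theorem blockOf_of_not_mem {x : Tor (fine n M)} (hx : ¬ blockReg n M (checker M w e ν) x) : blockOf n M x = w ∨ blockOf n M x = wp M w e ν := by
  by_contra h
  simp only [not_or] at h
  exact hx ⟨h.1, h.2⟩

/-- **NO FINE BOND JOINS `w` TO `w′`**: if both endpoints of a bond lie outside `Ω`, they lie in the SAME exterior block, so the indicator takes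
the same value at both (`2 ≤ M e`, `2 ≤ M ν`, `e ≠ ν`). [folklore] -/
theorem blockInd_eq_of_not_star (hMe : 2 ≤ M e) (hMν : 2 ≤ M ν) (hne : e ≠ ν) {x : Tor (fine n M)} {μ : Fin d}
    (hx : ¬ blockReg n M (checker M w e ν) x) (hx' : ¬ blockReg n M (checker M w e ν) (x + unitVec (fine n M) μ)) :
    blockInd n M w e ν (x + unitVec (fine n M) μ) = blockInd n M w e ν x := by
  rcases blockOf_add_unitVec n M x μ with h | h
  · simp only [blockInd, h]
  · rcases blockOf_of_not_mem n hx with h1 | h1 <;> rcases blockOf_of_not_mem n hx' with h2 | h2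
    · simp only [blockInd, h1, h2]
    · have hc : w + unitVec M μ = wp M w e ν :=
        calc w + unitVec M μ = blockOf n M x + unitVec M μ := by rw [h1]
          _ = blockOf n M (x + unitVec (fine n M) μ) := h.symm
          _ = wp M w e ν := h2
      exact absurd hc (w_add_ne_wp hMe hMν hne μ)
    · have hc : wp M w e ν + unitVec M μ = w :=
        calc wp M w e ν + unitVec M μ = blockOf n M x + unitVec M μ := by rw [h1]
          _ = blockOf n M (x + unitVec (fine n M) μ) := h.symm
          _ = w := h2
      exact absurd hc (wp_add_ne_w hMe hMν hne μ)
    · simp only [blockInd, h1, h2]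

/-! ## §2 The test field, its zero-extension and its curl -/

variable (M w e ν)

/-- **THE CHECKERBOARD TEST FIELD**: `A = ∂(1_{w′})` read on the star bonds of `Ω`. [folklore] -/
def testField : {b // starReg n M (checker M w e ν) b} → ℂ := fun b => (GradOp (fine n M) (n : ℂ) *ᵥ blockInd n M w e ν) b.1

variable {M w e ν}

/-- **ITS ZERO-EXTENSION IS THE FULL GRADIENT**: `ext A = ∂(1_{w′})` (the gradient of the indicator vanishes on every non-star bond).
[folklore] -/
theorem ext_testField (hMe : 2 ≤ M e) (hMν : 2 ≤ M ν) (hne : e ≠ ν) :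
    ext (starReg n M (checker M w e ν)) (testField n M w e ν) = GradOp (fine n M) (n : ℂ) *ᵥ blockInd n M w e ν := by
  funext b
  by_cases hb : starReg n M (checker M w e ν) b
  · exact ext_apply_of (starReg n M (checker M w e ν)) (testField n M w e ν) ⟨b, hb⟩
  · obtain ⟨x, μ⟩ := b
    have h1 : ¬ blockReg n M (checker M w e ν) x := fun h => hb (Or.inl h)
    have h2 : ¬ blockReg n M (checker M w e ν) (x + unitVec (fine n M) μ) := fun h => hb (Or.inr h)
    rw [ext_apply_of_not _ _ hb, GradOp_mulVec, sdiff_mulVec, blockInd_eq_of_not_star n hMe hMν hne h1 h2, sub_self, mul_zero]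

/-- **THE TEST FIELD IS CURL-FREE**: `curlR A = 0`. [folklore] -/
theorem curlR_testField (hMe : 2 ≤ M e) (hMν : 2 ≤ M ν) (hne : e ≠ ν) : curlR n M (checker M w e ν) *ᵥ testField n M w e ν = 0 := by
  rw [curlR, Matrix.smul_mulVec, submatrix_mulVec_eq, ext_testField n hMe hMν hne, CurlOp_mulVec_GradOp, smul_zero]

/-! ## §3 The mass term -/

/-- `Q′(1_{w′} ∘ blockOf) = 1_{w′}` on the unit torus. [folklore] -/
theorem QsOp_blockInd : QsOp n M *ᵥ blockInd n M w e ν = fun y => if y = wp M w e ν then 1 else 0 :=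
  QsOp_blockConst n M (fun y => if y = wp M w e ν then (1 : ℂ) else 0)

/-- the block averages of the test field are the unit gradient of the coarse indicator: `avgR A = ∂₁ 1_{w′}`. [folklore] -/
theorem avgR_testField (hMe : 2 ≤ M e) (hMν : 2 ≤ M ν) (hne : e ≠ ν) :
    avgR n M (checker M w e ν) *ᵥ testField n M w e ν = GradOp M 1 *ᵥ (fun y => if y = wp M w e ν then (1 : ℂ) else 0) := by
  rw [avgR_mulVec, ext_testField n hMe hMν hne, QvOp_GradOp_mulVec, QsOp_blockInd]

omit [NeZero n] in
/-- the unit gradient of a point indicator has `nsq ≤ 2d`. [folklore] -/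
theorem nsq_grad_indicator_le (z : Tor M) : nsq (GradOp M 1 *ᵥ (fun y => if y = z then (1 : ℂ) else 0)) ≤ 2 * d := by
  unfold nsq
  rw [Fintype.sum_prod_type, sum_comm]
  have hμ : ∀ μ : Fin d, ∑ y : Tor M, ‖(GradOp M 1 *ᵥ fun y => if y = z then (1 : ℂ) else 0) (y, μ)‖ ^ 2 ≤ 2 := by
    intro μ
    have hpt : ∀ y : Tor M, ‖(GradOp M 1 *ᵥ fun y => if y = z then (1 : ℂ) else 0) (y, μ)‖ ^ 2
        ≤ (if y + unitVec M μ = z then (1 : ℝ) else 0) + (if y = z then (1 : ℝ) else 0) := by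
      intro y
      rw [GradOp_mulVec, sdiff_mulVec, one_mul]
      split_ifs <;> simp
    refine (sum_le_sum fun y _ => hpt y).trans ?_
    have hsh : ∑ y : Tor M, (if y + unitVec M μ = z then (1 : ℝ) else 0) = ∑ y : Tor M, (if y = z then (1 : ℝ) else 0) :=
      Fintype.sum_equiv (Equiv.addRight (unitVec M μ)) _ _ (fun _ => rfl)
    rw [sum_add_distrib, hsh, sum_ite_eq' univ z, if_pos (mem_univ z)]
    norm_num
  calc ∑ μ : Fin d, ∑ y : Tor M, ‖(GradOp M 1 *ᵥ fun y => if y = z then (1 : ℂ) else 0) (y, μ)‖ ^ 2 ≤ ∑ _μ : Fin d, (2 : ℝ) :=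
        sum_le_sum fun μ _ => hμ μ
    _ = 2 * d := by rw [sum_const, card_univ, Fintype.card_fin, nsmul_eq_mul, mul_comm]

/-- **THE MASS TERM OF THE TEST FIELD**: `n^d·nsq (avgR A) ≤ 2d·n^d`. [folklore] -/
theorem mass_testField_le (hMe : 2 ≤ M e) (hMν : 2 ≤ M ν) (hne : e ≠ ν) :
    (n : ℝ) ^ d * nsq (avgR n M (checker M w e ν) *ᵥ testField n M w e ν) ≤ 2 * d * (n : ℝ) ^ d := by
  rw [avgR_testField n hMe hMν hne, mul_comm]
  exact mul_le_mul_of_nonneg_right (nsq_grad_indicator_le _) (by positivity)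

/-! ## §4 The Dirichlet data of the orbit -/

/-- the residual of ANY Dirichlet gauge is the gradient of `φ = 1_{w′} − ext μ` on the star bonds. [folklore] -/
theorem sub_gradR_eq (μ : {x // blockReg n M (checker M w e ν) x} → ℂ) (b : {b // starReg n M (checker M w e ν) b}) :
    (testField n M w e ν - gradR n M (checker M w e ν) *ᵥ μ) b
      = (GradOp (fine n M) (n : ℂ) *ᵥ (blockInd n M w e ν - ext (blockReg n M (checker M w e ν)) μ)) b.1 := by
  rw [Pi.sub_apply, testField, gradR, toBlock_mulVec', Matrix.mulVec_sub, Pi.sub_apply]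

/-- `φ = 0` on the sites of `w` (`w ≠ w′`, and `μ` is Dirichlet). [folklore] -/
theorem phi_on_w (hMe : 2 ≤ M e) (hne : e ≠ ν) (μ : {x // blockReg n M (checker M w e ν) x} → ℂ) {x : Tor (fine n M)}
    (hx : blockOf n M x = w) : (blockInd n M w e ν - ext (blockReg n M (checker M w e ν)) μ) x = 0 := by
  have h1 : blockOf n M x ≠ wp M w e ν := by rw [hx]; exact w_ne_wp hMe hne
  have h2 : ¬ blockReg n M (checker M w e ν) x := fun h => h.1 hx
  rw [Pi.sub_apply, blockInd_of_ne n h1, ext_apply_of_not _ _ h2, sub_zero]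

/-- `φ = 1` on the sites of `w′`. [folklore] -/
theorem phi_on_wp (μ : {x // blockReg n M (checker M w e ν) x} → ℂ) {x : Tor (fine n M)} (hx : blockOf n M x = wp M w e ν) :
    (blockInd n M w e ν - ext (blockReg n M (checker M w e ν)) μ) x = 1 := by
  have h2 : ¬ blockReg n M (checker M w e ν) x := fun h => h.2 hx
  rw [Pi.sub_apply, blockInd_of_wp n hx, ext_apply_of_not _ _ h2, sub_zero]

end Summit.QuantumFields.BalabanUV.T4Continuum.RegionGaugeCheckerboardField

end
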